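import Summits.AnomalousDissipation.AnomalousDissipation.Theorems.SawtoothPulseCascadeK1LocalisedCascadeKHLineKernel

/-!
# K2 lane (route-2 `SawtoothPulseCascade`, crux dir `K1LocalisedCascade`): the periodised line kernel — the lattice sum in closed form

Helper file of the K2 lane (ACL item stmt-AnomalousDissipation-19491), serving planner p4's typed slot map (`lineKernel`, used by `forcing` at
every offset `y₀ − y`). For `a > 0`, `κ = 2πa`, `z = e^{2πiβ}`, `q = e^{−κ}` and `r ∈ [0, 1)`:
`Σ_{n∈ℤ} e^{2πiβn} · (−e^{−κ|r−n|}/(2κ)) = −( e^{−κr}/(1 − z̄q) + z e^{κ(r−1)}/(1 − zq) )/(2κ)`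
as a `HasSum` over `ℤ` (`lineKernel_hasSum`: two geometric series, `n ≤ 0` and `n ≥ 1`). This is the closed form of p4's `lineKernel` on
`⌊y⌋ = 0` with the sign of BOTH branches negative (see `KHLineKernel` for the values at `r = 0, ½` against `Σ₀`, `S_β`, and the sign finding).
No definitions; no statement about the crux. [cite: Drazin2002, §8.3 (8.36)–(8.38)] [problem: turb]
-/

-- `Summit.<Summit>.<Problem>`: single-conjunct summit, the duplicate namespace segment is deliberate.
set_option linter.dupNamespace false

noncomputable section

namespace Summit.AnomalousDissipation.AnomalousDissipation.Theorems.SawtoothPulseCascade.K2PhaseBudget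

open Set Real Complex Literature.Analysis.FluidPDE.SawtoothCascade

/-- `conj e^{2πiβ} = e^{−2πiβ}`. [folklore] -/
theorem conj_blochZ (β : ℝ) :
    starRingEnd ℂ (Complex.exp (2 * Real.pi * β * Complex.I)) = Complex.exp (-(2 * Real.pi * β * Complex.I)) := by
  rw [← Complex.exp_conj]
  congr 1
  simp only [map_mul, map_ofNat, Complex.conj_ofReal, Complex.conj_I]
  ring

/-- **The lattice sum of the line kernel in closed form.** For `a > 0`, `r ∈ [0,1)`:
`Σ_{n∈ℤ} e^{2πiβn}·(−e^{−2πa|r−n|}/(4πa)) = −(e^{−2πa r}/(1 − z̄q) + z e^{2πa(r−1)}/(1 − zq))/(4πa)`, `z = e^{2πiβ}`, `q = e^{−2πa}`.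
[cite: Drazin2002, §8.3 (8.36)–(8.38)] -/
theorem lineKernel_hasSum {a β r : ℝ} (ha : 0 < a) (hr0 : 0 ≤ r) (hr1 : r < 1) :
    HasSum (fun n : ℤ => Complex.exp (2 * Real.pi * β * n * Complex.I) *
        (-((Real.exp (-(2 * Real.pi * a * |r - n|)) : ℂ) / (2 * (2 * Real.pi * a) : ℂ))))
      ((-((Real.exp (-(2 * Real.pi * a * r)) : ℂ) /
            (1 - starRingEnd ℂ (Complex.exp (2 * Real.pi * β * Complex.I)) * (Real.exp (-(2 * Real.pi * a)) : ℂ))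
          + (Real.exp (2 * Real.pi * a * (r - 1)) : ℂ) * Complex.exp (2 * Real.pi * β * Complex.I) /
            (1 - Complex.exp (2 * Real.pi * β * Complex.I) * (Real.exp (-(2 * Real.pi * a)) : ℂ)))) /
        (2 * (2 * Real.pi * a) : ℂ)) := by
  set z : ℂ := Complex.exp (2 * Real.pi * β * Complex.I) with hz
  set q : ℝ := Real.exp (-(2 * Real.pi * a)) with hq
  have hπ := Real.pi_pos
  have hκ : 0 < 2 * Real.pi * a := by positivity
  have hzn : ‖z‖ = 1 := by
    rw [hz, show (2 * Real.pi * β * Complex.I : ℂ) = ((2 * Real.pi * β : ℝ) : ℂ) * Complex.I by push_cast; ring]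
    exact Complex.norm_exp_ofReal_mul_I _
  have hzc : starRingEnd ℂ z = Complex.exp (-(2 * Real.pi * β * Complex.I)) := conj_blochZ β
  have hzn' : ‖starRingEnd ℂ z‖ = 1 := by rw [Complex.norm_conj]; exact hzn
  have hq0 : 0 < q := Real.exp_pos _
  have hq1 : q < 1 := by
    have h := Real.exp_lt_exp.2 (show -(2 * Real.pi * a) < 0 by linarith)
    rwa [Real.exp_zero] at h
  have hn1 : ‖starRingEnd ℂ z * (q : ℂ)‖ < 1 := by
    rw [norm_mul, hzn', one_mul, Complex.norm_real, Real.norm_eq_abs, abs_of_pos hq0]; exact hq1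
  have hn2 : ‖z * (q : ℂ)‖ < 1 := by
    rw [norm_mul, hzn, one_mul, Complex.norm_real, Real.norm_eq_abs, abs_of_pos hq0]; exact hq1
  have g1 := hasSum_geometric_of_norm_lt_one hn1
  have g2 := hasSum_geometric_of_norm_lt_one hn2
  -- powers of `z̄` and `z` as exponentials, powers of `q` as exponentials
  have hzpow : ∀ k : ℕ, Complex.exp (2 * Real.pi * β * (-(k : ℂ)) * Complex.I) = starRingEnd ℂ z ^ k := by
    intro k
    rw [hzc, ← Complex.exp_nat_mul]
    congr 1; ring
  have hzpow' : ∀ k : ℕ, Complex.exp (2 * Real.pi * β * ((k : ℂ) + 1) * Complex.I) = z * z ^ k := by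
    intro k
    rw [hz, ← Complex.exp_nat_mul, ← Complex.exp_add]
    congr 1; ring
  have hqpow : ∀ k : ℕ, Real.exp (-(2 * Real.pi * a * (r + k))) = Real.exp (-(2 * Real.pi * a * r)) * q ^ k := by
    intro k
    rw [hq, ← Real.exp_nat_mul, ← Real.exp_add]
    congr 1; ring
  have hqpow' : ∀ k : ℕ, Real.exp (-(2 * Real.pi * a * ((k : ℝ) + 1 - r))) = Real.exp (2 * Real.pi * a * (r - 1)) * q ^ k := by
    intro k
    rw [hq, ← Real.exp_nat_mul, ← Real.exp_add]
    congr 1; ring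
  -- pass to `n ↦ −n` and split `ℤ = ℕ ⊔ −(ℕ+1)`
  set f : ℤ → ℂ := fun n : ℤ => Complex.exp (2 * Real.pi * β * n * Complex.I) *
      (-((Real.exp (-(2 * Real.pi * a * |r - n|)) : ℂ) / (2 * (2 * Real.pi * a) : ℂ))) with hf
  rw [← (Equiv.neg ℤ).hasSum_iff]
  have hA : HasSum (fun k : ℕ => (f ∘ ⇑(Equiv.neg ℤ)) (k : ℤ))
      ((-((Real.exp (-(2 * Real.pi * a * r)) : ℂ)) / (2 * (2 * Real.pi * a) : ℂ)) * (1 - starRingEnd ℂ z * (q : ℂ))⁻¹) := by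
    have h : HasSum (fun i : ℕ => (-((Real.exp (-(2 * Real.pi * a * r)) : ℂ)) / (2 * (2 * Real.pi * a) : ℂ)) *
        (starRingEnd ℂ z * (q : ℂ)) ^ i) ((-((Real.exp (-(2 * Real.pi * a * r)) : ℂ)) / (2 * (2 * Real.pi * a) : ℂ)) *
          (1 - starRingEnd ℂ z * (q : ℂ))⁻¹) := g1.mul_left _
    refine h.congr_fun fun k => ?_
    have habs : |r - ((-(k : ℤ) : ℤ) : ℝ)| = r + k := by
      push_cast
      rw [sub_neg_eq_add, abs_of_nonneg (by positivity)]
    simp only [hf, Function.comp_apply, Equiv.neg_apply, habs, hqpow k]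
    push_cast
    rw [hzpow k, mul_pow]
    ring
  have hB : HasSum (fun k : ℕ => (f ∘ ⇑(Equiv.neg ℤ)) (-((k : ℤ) + 1)))
      ((-((Real.exp (2 * Real.pi * a * (r - 1)) : ℂ)) * z / (2 * (2 * Real.pi * a) : ℂ)) * (1 - z * (q : ℂ))⁻¹) := by
    have h : HasSum (fun i : ℕ => (-((Real.exp (2 * Real.pi * a * (r - 1)) : ℂ)) * z / (2 * (2 * Real.pi * a) : ℂ)) *
        (z * (q : ℂ)) ^ i) ((-((Real.exp (2 * Real.pi * a * (r - 1)) : ℂ)) * z / (2 * (2 * Real.pi * a) : ℂ)) *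
          (1 - z * (q : ℂ))⁻¹) := g2.mul_left _
    refine h.congr_fun fun k => ?_
    have hk0 : (0 : ℝ) ≤ k := Nat.cast_nonneg k
    have habs : |r - ((-(-((k : ℤ) + 1)) : ℤ) : ℝ)| = (k : ℝ) + 1 - r := by
      push_cast
      rw [neg_neg, abs_of_nonpos (by linarith)]
      ring
    simp only [hf, Function.comp_apply, Equiv.neg_apply, habs, hqpow' k]
    push_cast
    rw [neg_neg, hzpow' k, mul_pow]
    ring
  have hsum := hA.of_nat_of_neg_add_one hB
  have e : (-((Real.exp (-(2 * Real.pi * a * r)) : ℂ)) / (2 * (2 * Real.pi * a) : ℂ)) * (1 - starRingEnd ℂ z * (q : ℂ))⁻¹ +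
      (-((Real.exp (2 * Real.pi * a * (r - 1)) : ℂ)) * z / (2 * (2 * Real.pi * a) : ℂ)) * (1 - z * (q : ℂ))⁻¹ =
      (-((Real.exp (-(2 * Real.pi * a * r)) : ℂ) / (1 - starRingEnd ℂ z * (q : ℂ))
          + (Real.exp (2 * Real.pi * a * (r - 1)) : ℂ) * z / (1 - z * (q : ℂ)))) / (2 * (2 * Real.pi * a) : ℂ) := by
    ring
  rw [e] at hsum
  exact hsum

end Summit.AnomalousDissipation.AnomalousDissipation.Theorems.SawtoothPulseCascade.K2PhaseBudget

end
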